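import Summits.Parity.GeneralizedHardyLittlewood.Theorems.PrimeLevelFamEdgeIdeaDeltasExcZeroLedger
import Summits.Parity.GeneralizedHardyLittlewood.Theorems.PrimeLevelFamEdgeIdeaDeltasLayerTwist
import Literature.NumberTheory.LFunctions.ZetaRealAxis
import HarnessLib

/-!
# Route `PrimeLevelFamEdge` — TYPED IDEA DELTAS, deck 28d (LANDING NOTE typer ls-idea-typ-1 gen 4: lens-7 g30's
# `Sketch_Uquinquies_DHStrip.lean` sha16 b62825876c21de3e VERBATIM up to namespace `Summit.Parity.GeneralizedHardyLittlewood.Theses.PrimeLevelFamEdge.BeyondDiagonalBeatsQuarter.OffDiag.LensSevenSketchUquinquies`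
# → `…Theorems.PrimeLevelFamEdgeIdeaDeltas.ExcZeroLedgerStrip`; crux idea `l7-exceptional-clause-two-term-ledger` v2.5; D b135 / E b28;
# companion of decks 28/28b/28c; landed at the typer's discretion for the cell record.)
#
# Lens-7 (I7 Deuring–Heilbronn as input), crux idea `l7-exceptional-clause-two-term-ledger` v2.5 — U′-H:
# the Deuring–Heilbronn zero-free STRIP, read off the PROVED tree fact (cell ls-idea, gen 30; HOME-only sketch,
# evidence on stmt-Parity-20343; landable by ls-idea-typ-1 on request as a `PrimeLevelFamEdgeIdeaDeltas` deck)

Node L5′ ≡ U of K_B = `Summit.Parity.GeneralizedHardyLittlewood.Theses.PrimeLevelFamEdge.BeyondDiagonalBeatsQuarter`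
(stmt-Parity-20343), line `diagonal_kernel_split` REV 4, heart `stub_offDiagBelowSlack_io`, world (A) =
"an exceptional zero `β̃` of a real primitive `χ̃` mod `r ≤ P` at level `c_H/log P` exists" (U-E by_contra schema).

v2.1 §U′ of the card named ONE formula the lens owns at node U — the CONVERSION RATE of the exceptional hypothesis
into a zero-free region for everybody else: with `K := C_D·(1 − β̃)·log P` (the Deuring–Heilbronn factor of
conjuncts 3–4 of `gallagher1970_logFreeDensity`), every zero `ρ ≠ β̃` of `ζ` and of every primitive `L(s, χ)`,
`χ` mod `q ≤ P`, of height `≤ P⁶`, has `Re ρ ≤ 1 − w` as soon as `K·P^{c_D w} ≤ 1`, i.e. the strip has width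
`w_DH = log(1/K)/(c_D log P)` (Linnik's repulsion in Bombieri's Théorème 14 (ii) currency). The card's
First-lemma list left it UNTYPED as «U′-H … a successor can state it next to `DHWeightedZeroLedger`».
deck 28 (`…Theorems.PrimeLevelFamEdgeIdeaDeltas.ExcZeroLedger.excZeroPowerSum_le_rpow`) USES this floor
internally (its `floor_abs`), inside a weighted power sum over an admissible FAMILY; this file states and proves
the floor as a free-standing POINTWISE zero-free strip — the form in which v2.5 §«χ-face after K-L21-10» consumes
it against lens-21 g8's residual hypothesis `ChiFaceLL C s η N` (zero-free strip of width `C·log log N/log N`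
for conductors `1 < d ≤ N^{η}` at height `(log N)^{s}`): in world (A), on the §U window `N = D^{θ}`,
`θ₀ ≤ θ < 1/η′`, `P = D·N^{3η}`, `δ̃ ≤ C(log D)^{−2022}` (decks 28b/28c), one has
`w_DH ≥ ((A₀−1)·log log D − O(1))/(c_D(1+3ηθ) log D)`, which exceeds `C·log log N/log N`
by the factor `≈ (A₀−1)θ/(c_D(1+3ηθ)C) ≳ 10³` (pencil, illustrative constants) — so `ChiFaceLLIO` is
DISCHARGED in the route's own by_contra world at the window levels. THE WINDOW ARITHMETIC STAYS PENCIL; only the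
strip is kernel-checked here.

* `dhZeroFreeStrip` — for `P ≥ 2`, in world (A), for every `w` with `K·P^{c_D w} ≤ 1`:
  (ζ) every `ρ` in `weilZeroIndex_finite (P⁶)` has `Re ρ ≤ 1 − w`;
  (χ) every zero `ρ` (`0 < Re ρ < 1`, `|Im ρ| ≤ P⁶`) of a primitive `χ` mod `d ≤ P` (`d ≥ 2`) other
  than the exceptional triple `(r̃, χ̃, β̃)` has `Re ρ ≤ 1 − w` — INCLUDING the other zeros of `L(s, χ̃)` itself.
* `dhZeroFreeStrip_logWidth` — the same with the floor in logarithmic form `c_D·w·log P ≤ −log K`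
  (width `w_DH = log(1/K)/(c_D log P)`; `K > 0` automatically since `β̃ < 1`).
* `chiFaceLL_of_excZero` — COMPOSITION with deck 32 (`…IdeaDeltas.LayerTwist.ChiFaceLL`, lens-21 g8, landed
  p660191): in world (A), at every scale `N` with `N^η < r̃` (the exceptional conductor ABOVE the strip family),
  `N^η ≤ P`, `(log N)^s ≤ P⁶`, `C·log log N/log N ≤ 1` and the floor `K·P^{c_D·C·log log N/log N} ≤ 1`, the typed
  hedge `ChiFaceLL C s η N` HOLDS — for ALL characters mod `d`, `1 < d ≤ N^η` (imprimitive ones reduced to their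
  primitive inducing character via `changeLevel_primitiveCharacter` / `LFunction_changeLevel`, the Euler factors
  `1 − χ⋆(p)p^{−ρ}` being zero-free on `Re ρ > 0`; principal ones to `ζ` via `LFunctionTrivChar_eq_mul_riemannZeta`,
  real zeros of `ζ` on `(0,1)` excluded by the tree's `riemannZeta_ofReal_ne_zero_of_pos_of_lt_one`; `Re ρ ≤ 0` trivial).
  The WINDOW ARITHMETIC (that these five side conditions hold at `N = D_j^θ`, `θ_LL ≤ θ < 1/η`, `P = D_j N^{3η}`, for
  `j ≥ j₀` along `ExcSequence 2022`) stays PENCIL (card §v2.5 (χ-W)).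
Ingredients (all PROVED in tree, no named fact consumed): `gallagher1970_logFreeDensity_holds` conjuncts 3–4,
`riemannZetaZeroOrder_pos_iff`, `DirichletDisc.zeroOrder_pos_iff`, `eq_one_of_isPrimitive_one`, deck 28's
`single_le_sum₃`; the (χ) part instantiates conjunct 4 with the SINGLETON family `Z(q, χ') = {ρ} ∩ {L(·,χ') = 0}`
(the zero condition quantified over the `Prop`-instance `NeZero q`, so that `Z` is defined at every modulus);
the composition uses Mathlib's `DirichletCharacter.changeLevel_primitiveCharacter`, `LFunction_changeLevel`,
`LFunctionTrivChar_eq_mul_riemannZeta`, `norm_le_one`, `Complex.norm_natCast_cpow_of_pos` and deck 32's `ChiFaceLL` (def only).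

HONESTY: no exceptional-zero theorem (no Landau–Siegel / Siegel-zero exclusion, no Theorem 1–2 of
arXiv:2211.02515, no repaired Margin232) is proved here or by ideation; the exceptional world is ASSUMED
(hypothesis `IsExceptionalZero cH P r χe β`), never refuted or produced; the strip is Linnik 1944 / Bombieri
Thm 14 (ii) (KNOWN lever; in-cell delta = typed → PROVED, support value); the comparison with `ChiFaceLL` is PENCIL;
nothing about U / (S) / R⋆ / hR or `stub_offDiagBelowSlack_io` is bounded; typed ≠ proved; located ≠ endorsed.
-/

noncomputable section

open Finset Real
open Literature.NumberTheory.LFunctions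
open Literature.NumberTheory.Sieve.MontgomeryVaughan1975
open Summit.Parity.GeneralizedHardyLittlewood.Theorems.PrimeLevelFamEdgeIdeaDeltas.ExcZeroLedger

namespace Summit.Parity.GeneralizedHardyLittlewood.Theorems.PrimeLevelFamEdgeIdeaDeltas.ExcZeroLedgerStrip

open scoped Classical in
/-- **U′-H — the Deuring–Heilbronn zero-free strip (floor form).** With the constants `c_D, C_D, c_H` of
`gallagher1970_logFreeDensity` and `K := C_D (1 − β̃) log P`: if `β̃` is an exceptional zero at level `c_H`
(`IsExceptionalZero c_H P r χ̃ β̃`, `P ≥ 2`) and `K·P^{c_D w} ≤ 1`, then (ζ) every zero of `ζ` indexed in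
`weilZeroIndex_finite (P⁶)` and (χ) every non-trivial zero of height `≤ P⁶` of a primitive character mod
`d ≤ P`, `d ≥ 2`, other than the term `(r̃, χ̃, β̃)` itself, satisfies `Re ρ ≤ 1 − w`.
(A genuine zero weighs `≥ 1` in conjuncts 3–4 of the density fact, whose right-hand side is `< 1` beyond
depth `w`.) [cite: Bombieri1987GrandCrible, §6 Théorème 14] [cite: Gallagher1970Density, Theorem 6] -/
theorem dhZeroFreeStrip :
    ∃ c_D C_D cH : ℝ, 0 < c_D ∧ 0 < C_D ∧ 0 < cH ∧
      ∀ P : ℝ, 2 ≤ P → ∀ (r : ℕ) [NeZero r] (χe : DirichletCharacter ℂ r) (β : ℝ),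
        IsExceptionalZero cH P r χe β → ∀ w : ℝ,
          C_D * ((1 - β) * Real.log P) * P ^ (c_D * w) ≤ 1 →
          (∀ ρ ∈ (weilZeroIndex_finite (P ^ 6)).toFinset, ρ.re ≤ 1 - w) ∧
          (∀ (d : ℕ) [NeZero d] (χ : DirichletCharacter ℂ d), 2 ≤ d → (d : ℝ) ≤ P → χ.IsPrimitive →
            ∀ ρ : ℂ, χ.LFunction ρ = 0 → 0 < ρ.re → ρ.re < 1 → |ρ.im| ≤ P ^ 6 →
              ¬ (d = r ∧ (∀ n : ℕ, χ (n : ZMod d) = χe (n : ZMod r)) ∧ ρ = ((β : ℝ) : ℂ)) →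
              ρ.re ≤ 1 - w) := by
  obtain ⟨c_D, C_D, cH, hcD, hCD, hcH, -, -, hDHζ, hDH⟩ := gallagher1970_logFreeDensity_holds
  refine ⟨c_D, C_D, cH, hcD, hCD, hcH, fun P hP2 r _ χe β hEZ w hK1 => ?_⟩
  have hP1' : (1 : ℝ) < P := by linarith
  have hlogP : 0 < Real.log P := Real.log_pos hP1'
  have hEZ' := hEZ
  obtain ⟨-, -, -, -, hβ1, -⟩ := hEZ'
  set K : ℝ := C_D * ((1 - β) * Real.log P) with hKdef
  have hK0 : 0 ≤ K := mul_nonneg hCD.le (mul_nonneg (by linarith) hlogP.le)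
  -- THE FLOOR MECHANISM (deck 28 `floor_abs`): a weight `≥ 1` at real part `> 1 − w` contradicts the
  -- density bound with the Deuring–Heilbronn factor once `K·P^{c_D w} ≤ 1`
  have floor_abs : ∀ {σ m S : ℝ}, 1 - w < σ → 1 ≤ m → m ≤ S → S ≤ K * P ^ (c_D * (1 - σ)) →
      False := by
    intro σ m S hσ hm hmS hS
    have hexp : c_D * (1 - σ) < c_D * w := mul_lt_mul_of_pos_left (by linarith) hcD
    rcases hK0.eq_or_lt with hK | hK
    · rw [← hK, zero_mul] at hS
      linarith
    · have hlt : K * P ^ (c_D * (1 - σ)) < K * P ^ (c_D * w) :=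
        mul_lt_mul_of_pos_left (Real.rpow_lt_rpow_of_exponent_lt hP1' hexp) hK
      linarith
  refine ⟨fun ρ hρ => ?_, fun d _ χ hd2 hdP hχp ρ hLρ hρ0 hρ1 hρim hnot => ?_⟩
  · -- (ζ) the zeros of `ζ` in the box
    have hmem := mem_toFinset_weilZeroIndex hρ
    have hζw : ∀ ρ' ∈ (weilZeroIndex_finite (P ^ 6)).toFinset,
        0 ≤ ((riemannZetaZeroOrder ρ' : ℤ) : ℝ) :=
      fun ρ' hρ' => (mem_toFinset_weilZeroIndex hρ').2.2.2.2.2.2.2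
    by_contra hcon
    push Not at hcon
    have hm1 : (1 : ℝ) ≤ ((riemannZetaZeroOrder ρ : ℤ) : ℝ) := by
      have h := (riemannZetaZeroOrder_pos_iff hmem.2.2.2.2.2.2.1).mpr hmem.1
      have h' : (1 : ℤ) ≤ riemannZetaZeroOrder ρ := by omega
      exact_mod_cast h'
    have hd := hDHζ P hP2 r χe β hEZ ρ.re hmem.2.1 hmem.2.2.1
    have hsingle : ((riemannZetaZeroOrder ρ : ℤ) : ℝ) ≤
        ∑ ρ' ∈ (weilZeroIndex_finite (P ^ 6)).toFinset with ρ.re ≤ ρ'.re,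
          ((riemannZetaZeroOrder ρ' : ℤ) : ℝ) :=
      Finset.single_le_sum (f := fun ρ' => ((riemannZetaZeroOrder ρ' : ℤ) : ℝ))
        (fun ρ' hρ' => hζw ρ' (Finset.mem_filter.mp hρ').1) (Finset.mem_filter.mpr ⟨hρ, le_rfl⟩)
    exact floor_abs hcon hm1 hsingle hd
  · -- (χ) conjunct 4 on the SINGLETON family at `(d, χ)` = `(q' + 1, χ)`, the exceptional term removed
    obtain ⟨q', rfl⟩ : ∃ q', d = q' + 1 := ⟨d - 1, by omega⟩
    have hq'1 : 1 ≤ q' := by omega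
    -- (the zero condition is quantified over the `NeZero` instance so that the family is defined at every
    -- modulus `q`; `NeZero` is a `Prop`, so at `q'' + 1` it is the usual `L(ρ', χ') = 0`)
    set Z : (q : ℕ) → DirichletCharacter ℂ q → Finset ℂ := fun q χ' =>
      ({ρ} : Finset ℂ).filter fun ρ' => ∀ _h : NeZero q, χ'.LFunction ρ' = 0 with hZdef
    have hZmem : ∀ (q'' : ℕ) (χ' : DirichletCharacter ℂ (q'' + 1)), ∀ ρ' ∈ Z (q'' + 1) χ',
        χ'.LFunction ρ' = 0 ∧ 0 < ρ'.re ∧ ρ'.re < 1 ∧ |ρ'.im| ≤ P ^ 6 := by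
      intro q'' χ' ρ' hρ'
      simp only [hZdef, Finset.mem_filter, Finset.mem_singleton] at hρ'
      obtain ⟨rfl, hL⟩ := hρ'
      exact ⟨hL inferInstance, hρ0, hρ1, hρim⟩
    have hρZ : ρ ∈ Z (q' + 1) χ := by
      simp only [hZdef, Finset.mem_filter, Finset.mem_singleton, true_and]
      exact fun _ => hLρ
    have hq'mem : q' ∈ Ico 1 ⌊P⌋₊ := by
      refine Finset.mem_Ico.mpr ⟨hq'1, ?_⟩
      have h : q' + 1 ≤ ⌊P⌋₊ := Nat.le_floor hdP
      omega
    have hχ1 : χ ≠ 1 := by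
      intro hχ
      subst hχ
      have := eq_one_of_isPrimitive_one hχp
      omega
    by_contra hcon
    push Not at hcon
    have hm1 : (1 : ℝ) ≤ (DirichletDisc.zeroOrder χ ρ : ℝ) := by
      have h := (DirichletDisc.zeroOrder_pos_iff χ hχ1 ρ).mpr hLρ
      have h' : 1 ≤ DirichletDisc.zeroOrder χ ρ := h
      exact_mod_cast h'
    have hd := hDH P hP2 r χe β hEZ Z hZmem ρ.re hρ0.le hρ1.le
    have hχmem : χ ∈ (univ : Finset (DirichletCharacter ℂ (q' + 1))).filter
        (fun χ' => χ'.IsPrimitive) := Finset.mem_filter.mpr ⟨Finset.mem_univ _, hχp⟩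
    have hρ' : ρ ∈ (Z (q' + 1) χ).filter (fun ρ' => ρ.re ≤ ρ'.re ∧
        ¬ (q' + 1 = r ∧ (∀ n : ℕ, χ (n : ZMod (q' + 1)) = χe (n : ZMod r)) ∧
          ρ' = ((β : ℝ) : ℂ))) := Finset.mem_filter.mpr ⟨hρZ, le_rfl, hnot⟩
    have hsingle := single_le_sum₃ (Ico 1 ⌊P⌋₊)
      (fun q'' => (univ : Finset (DirichletCharacter ℂ (q'' + 1))).filter fun χ' => χ'.IsPrimitive)
      (fun q'' χ' => (Z (q'' + 1) χ').filter fun ρ' => ρ.re ≤ ρ'.re ∧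
        ¬ (q'' + 1 = r ∧ (∀ n : ℕ, χ' (n : ZMod (q'' + 1)) = χe (n : ZMod r)) ∧
          ρ' = ((β : ℝ) : ℂ)))
      (fun q'' χ' ρ' => (DirichletDisc.zeroOrder χ' ρ' : ℝ)) (fun _ _ _ => Nat.cast_nonneg _)
      hq'mem hχmem hρ'
    exact floor_abs hcon hm1 hsingle hd

/-- **U′-H, logarithmic form — the Deuring–Heilbronn width `w_DH = log(1/K)/(c_D log P)`.** Same
constants; the floor `K·P^{c_D w} ≤ 1` is implied by `c_D·w·log P ≤ −log K` (`K = C_D (1 − β̃) log P > 0`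
because `β̃ < 1`). In the card's window coordinates (`N = D^θ`, `P = D·N^{3η}`, `1 − β̃ ≤ C(log D)^{−A₀}`,
`A₀ = 2022`) this is the strip `Re ρ ≤ 1 − ((A₀−1) log log D − O(1))/(c_D (1+3ηθ) log D)` — PENCIL beyond
this statement. [cite: Bombieri1987GrandCrible, §6 Théorème 14] -/
theorem dhZeroFreeStrip_logWidth :
    ∃ c_D C_D cH : ℝ, 0 < c_D ∧ 0 < C_D ∧ 0 < cH ∧
      ∀ P : ℝ, 2 ≤ P → ∀ (r : ℕ) [NeZero r] (χe : DirichletCharacter ℂ r) (β : ℝ),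
        IsExceptionalZero cH P r χe β → ∀ w : ℝ,
          c_D * w * Real.log P ≤ - Real.log (C_D * ((1 - β) * Real.log P)) →
          (∀ ρ ∈ (weilZeroIndex_finite (P ^ 6)).toFinset, ρ.re ≤ 1 - w) ∧
          (∀ (d : ℕ) [NeZero d] (χ : DirichletCharacter ℂ d), 2 ≤ d → (d : ℝ) ≤ P → χ.IsPrimitive →
            ∀ ρ : ℂ, χ.LFunction ρ = 0 → 0 < ρ.re → ρ.re < 1 → |ρ.im| ≤ P ^ 6 →
              ¬ (d = r ∧ (∀ n : ℕ, χ (n : ZMod d) = χe (n : ZMod r)) ∧ ρ = ((β : ℝ) : ℂ)) →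
              ρ.re ≤ 1 - w) := by
  obtain ⟨c_D, C_D, cH, hcD, hCD, hcH, hmain⟩ := dhZeroFreeStrip
  refine ⟨c_D, C_D, cH, hcD, hCD, hcH, fun P hP2 r _ χe β hEZ w hw => hmain P hP2 r χe β hEZ w ?_⟩
  have hP0 : 0 < P := by linarith
  have hP1' : (1 : ℝ) < P := by linarith
  have hlogP : 0 < Real.log P := Real.log_pos hP1'
  have hEZ' := hEZ
  obtain ⟨-, -, -, -, hβ1, -⟩ := hEZ'
  set K : ℝ := C_D * ((1 - β) * Real.log P) with hKdef
  have hKpos : 0 < K := mul_pos hCD (mul_pos (by linarith) hlogP)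
  have hpow : P ^ (c_D * w) ≤ 1 / K := by
    rw [Real.rpow_def_of_pos hP0]
    calc Real.exp (Real.log P * (c_D * w)) ≤ Real.exp (- Real.log K) := by
          refine Real.exp_le_exp.mpr ?_
          have : Real.log P * (c_D * w) = c_D * w * Real.log P := by ring
          linarith
      _ = 1 / K := by rw [Real.exp_neg, Real.exp_log hKpos, one_div]
  calc K * P ^ (c_D * w) ≤ K * (1 / K) := mul_le_mul_of_nonneg_left hpow hKpos.le
    _ = 1 := mul_one_div_cancel hKpos.ne'

/-- Euler factors do not vanish in the right half-plane: `1 − z·p^{−s} ≠ 0` for `p ≥ 2`, `‖z‖ ≤ 1`,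
`Re s > 0`. [folklore] -/
theorem one_sub_mul_cpow_neg_ne_zero {p : ℕ} (hp : 2 ≤ p) {z : ℂ} (hz : ‖z‖ ≤ 1) {s : ℂ}
    (hs : 0 < s.re) : 1 - z * (p : ℂ) ^ (-s) ≠ 0 := by
  intro h
  have h1 : z * (p : ℂ) ^ (-s) = 1 := (sub_eq_zero.mp h).symm
  have hnorm : ‖z * (p : ℂ) ^ (-s)‖ < 1 := by
    rw [norm_mul, Complex.norm_natCast_cpow_of_pos (by omega) (-s)]
    have hp1 : (1 : ℝ) < p := by exact_mod_cast (lt_of_lt_of_le one_lt_two hp)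
    have hlt : (p : ℝ) ^ (-s).re < 1 :=
      Real.rpow_lt_one_of_one_lt_of_neg hp1 (by rw [Complex.neg_re]; linarith)
    have hnn : 0 ≤ (p : ℝ) ^ (-s).re := Real.rpow_nonneg (by positivity) _
    calc ‖z‖ * (p : ℝ) ^ (-s).re ≤ 1 * (p : ℝ) ^ (-s).re := mul_le_mul_of_nonneg_right hz hnn
      _ < 1 := by rw [one_mul]; exact hlt
  rw [h1, norm_one] at hnorm
  exact lt_irrefl _ hnorm

open Summit.Parity.GeneralizedHardyLittlewood.Theorems.PrimeLevelFamEdgeIdeaDeltas.LayerTwist in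
/-- **World (A) PAYS the log-log hedge — composition with deck 32's `ChiFaceLL`.** With the constants of
`gallagher1970_logFreeDensity` and `K := C_D (1 − β̃) log P`: if `β̃` is an exceptional zero at level `c_H`
of a primitive `χ̃` mod `r̃` (`IsExceptionalZero c_H P r̃ χ̃ β̃`, `P ≥ 2`) and at the scale `N` one has
`N^η < r̃` (the exceptional conductor above the family), `N^η ≤ P`, `(log N)^s ≤ P⁶`,
`C·log log N/log N ≤ 1` and the Deuring–Heilbronn floor `K·P^{c_D·(C·log log N/log N)} ≤ 1`, then lens-21's
typed hedge `ChiFaceLL C s η N` (no zero of any `L(s,χ)`, `χ` mod `d`, `1 < d ≤ N^η`, `|Im ρ| ≤ (log N)^s`, in the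
strip `1 − C log log N/log N < Re ρ < 1`) HOLDS. Imprimitive characters are reduced to their primitive inducing
character (`changeLevel_primitiveCharacter`, `LFunction_changeLevel`; Euler factors zero-free on `Re s > 0`),
principal ones to `ζ` (`LFunctionTrivChar_eq_mul_riemannZeta`; no real zeros of `ζ` on `(0,1)`,
`riemannZeta_ofReal_ne_zero_of_pos_of_lt_one`), and `Re ρ ≤ 0` is below the strip. The window arithmetic
(card §v2.5 (χ-W): the five side conditions at `N = D_j^θ`, `θ_LL ≤ θ < 1/η`) is NOT proved here.
[cite: Bombieri1987GrandCrible, §6 Théorème 14] [cite: Linnik1944] -/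
theorem chiFaceLL_of_excZero :
    ∃ c_D C_D cH : ℝ, 0 < c_D ∧ 0 < C_D ∧ 0 < cH ∧
      ∀ P : ℝ, 2 ≤ P → ∀ (r : ℕ) [NeZero r] (χe : DirichletCharacter ℂ r) (β : ℝ),
        IsExceptionalZero cH P r χe β → ∀ C s η N : ℝ,
          N ^ η < (r : ℝ) → N ^ η ≤ P → Real.log N ^ s ≤ P ^ 6 →
          C * (Real.log (Real.log N) / Real.log N) ≤ 1 →
          C_D * ((1 - β) * Real.log P) * P ^ (c_D * (C * (Real.log (Real.log N) / Real.log N))) ≤ 1 →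
          ChiFaceLL C s η N := by
  obtain ⟨c_D, C_D, cH, hcD, hCD, hcH, hmain⟩ := dhZeroFreeStrip
  refine ⟨c_D, C_D, cH, hcD, hCD, hcH,
    fun P hP2 r _ χe β hEZ C s η N hr hNP hsP hw1 hfloor => ?_⟩
  obtain ⟨hζ, hχ⟩ := hmain P hP2 r χe β hEZ (C * (Real.log (Real.log N) / Real.log N)) hfloor
  unfold ChiFaceLL
  intro d _ χ hd1 hdN ρ hLρ him hre1
  have himP : |ρ.im| ≤ P ^ 6 := him.trans hsP
  by_cases hre0 : ρ.re ≤ 0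
  · linarith
  push Not at hre0
  have hρ1 : ρ ≠ 1 := by
    intro h
    rw [h, Complex.one_re] at hre1
    exact lt_irrefl _ hre1
  by_cases hχ1 : χ = 1
  · -- principal row: the zeros in `0 < Re s < 1` are zeros of `ζ` (Euler factors do not vanish there)
    subst hχ1
    have h' : (1 : DirichletCharacter ℂ d).LFunction ρ =
        (∏ p ∈ d.primeFactors, (1 - (p : ℂ) ^ (-ρ))) * riemannZeta ρ :=
      DirichletCharacter.LFunctionTrivChar_eq_mul_riemannZeta hρ1
    rw [h'] at hLρ
    rcases mul_eq_zero.mp hLρ with hprod | hζ0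
    · exfalso
      obtain ⟨p, hp, hp0⟩ := Finset.prod_eq_zero_iff.mp hprod
      have h1 := one_sub_mul_cpow_neg_ne_zero (Nat.prime_of_mem_primeFactors hp).two_le
        (z := 1) (by simp) hre0 (s := ρ)
      rw [one_mul] at h1
      exact h1 hp0
    · have him0 : ρ.im ≠ 0 := by
        intro h0
        have hρeq : ρ = ((ρ.re : ℝ) : ℂ) := by
          apply Complex.ext <;> simp [h0]
        have hz : riemannZeta ((ρ.re : ℝ) : ℂ) = 0 := by rw [← hρeq]; exact hζ0
        exact riemannZeta_ofReal_ne_zero_of_pos_of_lt_one ρ.re hre0 hre1 hz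
      have hmem : ρ ∈ (weilZeroIndex_finite (P ^ 6)).toFinset :=
        (Set.Finite.mem_toFinset _).mpr ⟨hζ0, hre0.le, hre1.le, him0, himP⟩
      exact hζ ρ hmem
  · -- non-principal row: reduce to the primitive inducing character `χ⋆` mod `d⋆ = conductor χ ≥ 2`
    have hc0 : χ.conductor ≠ 0 := DirichletCharacter.conductor_ne_zero (χ := χ)
    have hc1 : χ.conductor ≠ 1 := fun h =>
      hχ1 ((DirichletCharacter.eq_one_iff_conductor_eq_one (χ := χ)).mpr h)
    haveI : NeZero χ.conductor := ⟨hc0⟩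
    have hc2 : 2 ≤ χ.conductor := by omega
    have hcd : χ.conductor ≤ d :=
      Nat.le_of_dvd (by omega) (DirichletCharacter.conductor_dvd_level (χ := χ))
    have hfac := DirichletCharacter.LFunction_changeLevel
      (DirichletCharacter.conductor_dvd_level (χ := χ)) χ.primitiveCharacter (s := ρ) (Or.inr hρ1)
    rw [DirichletCharacter.changeLevel_primitiveCharacter] at hfac
    rw [hfac] at hLρ
    have hLs : χ.primitiveCharacter.LFunction ρ = 0 := by
      rcases mul_eq_zero.mp hLρ with h0 | hprod
      · exact h0
      · exfalso
        obtain ⟨p, hp, hp0⟩ := Finset.prod_eq_zero_iff.mp hprod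
        exact one_sub_mul_cpow_neg_ne_zero (Nat.prime_of_mem_primeFactors hp).two_le
          (DirichletCharacter.norm_le_one _ _) hre0 hp0
    have hlev : ((χ.conductor : ℕ) : ℝ) ≤ P :=
      calc ((χ.conductor : ℕ) : ℝ) ≤ d := by exact_mod_cast hcd
        _ ≤ N ^ η := hdN
        _ ≤ P := hNP
    have hnot : ¬ (χ.conductor = r ∧
        (∀ n : ℕ, χ.primitiveCharacter (n : ZMod χ.conductor) = χe (n : ZMod r)) ∧
          ρ = ((β : ℝ) : ℂ)) := by
      rintro ⟨h, -, -⟩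
      have hle : (r : ℝ) ≤ N ^ η :=
        calc (r : ℝ) = ((χ.conductor : ℕ) : ℝ) := by exact_mod_cast h.symm
          _ ≤ d := by exact_mod_cast hcd
          _ ≤ N ^ η := hdN
      linarith
    exact hχ χ.conductor χ.primitiveCharacter hc2 hlev
      (DirichletCharacter.primitiveCharacter_isPrimitive χ) ρ hLs hre0 hre1 himP hnot

end Summit.Parity.GeneralizedHardyLittlewood.Theorems.PrimeLevelFamEdgeIdeaDeltas.ExcZeroLedgerStrip
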